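import Literature.Probability.RandomPlanarGeometry.HexSAWBrickWallStripFugacityWidthOneContactGaussianMGF
import HarnessLib

/-!
# Moderate deviations of the contact number: the log-mgf expansion uniform in `|s| ≤ δ√N`, and Gaussian-rate tails at all scales `√N ≪ a_N ≪ N`

Topic `Literature/Probability/RandomPlanarGeometry` (continues `HexSAWBrickWallStripFugacityWidthOneContactGaussianMGF.lean`: `M_N(s) → e^{σ²s²/2}` for each
fixed real `s`, `M_N(s) = C_{1,N}(y e^{s/√N}, z)/C_{1,N}(y,z)·e^{−s√N b}`, `σ² = d/dA b(e^A,z)|_{log y}`).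
THIS FILE makes the expansion UNIFORM in the tilt and draws the moderate-deviation consequence:

* §2 ★★★ `abs_log_contactMGF_sub_le`: for every `η > 0` there is `δ > 0` such that for all large `N` and ALL real `s` with `|s| ≤ δ√N`,
  `|log M_N(s) − σ²s²/2| ≤ η s² + η` (second-order Taylor squeeze of the `C²` free energy on `|u| ≤ δ`, continuity of the parity amplitudes,
  uniform remainder of `…UniformAmplitude`).
* §3 ★★★ `eventually_contactUpperTail_le_exp_moderate` / ★★★ `eventually_contactLowerTail_le_exp_moderate` — MODERATE DEVIATIONS, UPPER BOUND
  WITH THE GAUSSIAN RATE: for every sequence `x_N → ∞` with `x_N/√N → 0` and every `η > 0`, for all large `N`,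
  `P_{N,y,z}(bc ≥ N b + x_N√N) ≤ exp(−(1−η)·x_N²/(2σ²))` and `P_{N,y,z}(bc ≤ N b − x_N√N) ≤ exp(−(1−η)·x_N²/(2σ²))`
  — i.e. `limsup x_N^{-2} log P_N(|bc − Nb| ≥ x_N√N) ≤ −1/(2σ²)` at every scale strictly between the CLT scale `√N` and the LDP scale `N`.

Numerics (`mdp_check.py`, exact series, `(y,z) = (2,1)`, `σ² = 0.1859`, Gaussian rate `−1/(2σ²) = −2.689`; `x_N = N^{1/4}/2`):
`x_N^{-2} log P_N(bc ≥ Nb + x_N√N) = −4.11, −3.74, −3.35, −3.22` and lower tail `−3.90, −3.69, −3.32, −3.20` (`N = 100, 200, 400, 800`) — below the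
bound and creeping up to the Gaussian rate (the polynomial prefactor costs `≈ (log x_N)/x_N²`).

## Sources
A. Dembo, O. Zeitouni, *Large Deviations Techniques and Applications* (2010) §2.3 (Gärtner–Ellis upper bound via the exponential Chebyshev
inequality) and §3.7 (moderate deviations; lane statement); N. Madras, G. Slade (1993) §1.1; N. R. Beaton et al., CMP 326 (2014), arXiv:1109.0358v5
§3.2 Proposition 6 (p. 10).  Nothing is quoted AS PRINTED; statements and constants are this lineage's.
-/

noncomputable section

open Filter Topology Finset Set Literature.Analysis
open Literature.Probability.LatticeModels Literature.Probability.Percolation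

namespace Literature.Probability.RandomPlanarGeometry.SAW.HexBW

namespace WidthOneYZ

variable {y z : ℝ}

/-! ## §1 Plumbing (private copies of the parent's private lemmas) -/

/-- (plumbing; private copy of the parent's private lemma) Derivative data from `C²`. [cite: DemboZeitouni2010, §2.3 (lane plumbing)] -/
private theorem derivData_of_contDiff_two₃ {g : ℝ → ℝ} (hg : ContDiff ℝ 2 g) (τ : ℝ) :
    (∀ t, HasDerivAt g (deriv g t) t) ∧ (∀ t, HasDerivAt (deriv g) (deriv (deriv g) t) t) ∧
      Continuous (deriv (deriv g)) ∧ ∃ B, ∀ t ∈ Icc (-τ) τ, |deriv (deriv g) t| ≤ B := by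
  have h1 : Differentiable ℝ g := hg.differentiable (by norm_num)
  have h2 : ContDiff ℝ 1 (deriv g) :=
    (contDiff_succ_iff_deriv.1 (show ContDiff ℝ ((1 : WithTop ℕ∞) + 1) g from hg)).2.2
  have h3 : Differentiable ℝ (deriv g) := h2.differentiable (by norm_num)
  have h4 : Continuous (deriv (deriv g)) :=
    ((contDiff_succ_iff_deriv.1 (show ContDiff ℝ ((0 : WithTop ℕ∞) + 1) (deriv g) from h2)).2.2).continuous
  refine ⟨fun t => (h1 t).hasDerivAt, fun t => (h3 t).hasDerivAt, h4, ?_⟩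
  obtain ⟨B, hB⟩ := isCompact_Icc.exists_bound_of_continuousOn (h4.continuousOn (s := Icc (-τ) τ))
  exact ⟨B, fun t ht => by simpa [Real.norm_eq_abs] using hB t ht⟩

/-- If `ψ(0) = 0`, `ψ' = ψ₁` with `ψ₁(0) = 0`, `ψ₁' = ψ₂` and `|ψ₂| ≤ η` on `[-δ, δ]`, then `|ψ(u)| ≤ η·u²` for `|u| ≤ δ` (two mean-value steps).
[cite: DemboZeitouni2010, §2.3 (lane plumbing)] -/
private theorem abs_le_of_second_deriv_bound₃ {ψ ψ₁ ψ₂ : ℝ → ℝ} {δ η : ℝ} (h0 : ψ 0 = 0) (h10 : ψ₁ 0 = 0)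
    (hd : ∀ u, HasDerivAt ψ (ψ₁ u) u) (hd1 : ∀ u, HasDerivAt ψ₁ (ψ₂ u) u) (hη : ∀ u ∈ Icc (-δ) δ, |ψ₂ u| ≤ η)
    {u : ℝ} (hu : u ∈ Icc (-δ) δ) : |ψ u| ≤ η * u ^ 2 := by
  have hη0 : 0 ≤ η := by
    have := hη 0 ⟨by linarith [hu.1, hu.2, abs_nonneg u], by linarith [hu.1, hu.2]⟩
    exact le_trans (abs_nonneg _) this
  -- `|ψ₁ v| ≤ η |v|` for `|v| ≤ |u|`
  have step1 : ∀ v, v ∈ Icc (-δ) δ → |ψ₁ v| ≤ η * |v| := by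
    intro v hv
    rcases lt_trichotomy v 0 with hv0 | hv0 | hv0
    · obtain ⟨ξ, hξ, e⟩ := exists_hasDerivAt_eq_slope ψ₁ ψ₂ hv0 (fun t _ => (hd1 t).continuousAt.continuousWithinAt)
        (fun t _ => hd1 t)
      rw [h10] at e
      have e' : ψ₁ v = ψ₂ ξ * v := by
        have : 0 - ψ₁ v = ψ₂ ξ * (0 - v) := by rw [e, div_mul_cancel₀ _ (sub_ne_zero.2 hv0.ne')]
        linarith
      rw [e', abs_mul]
      exact mul_le_mul_of_nonneg_right (hη ξ ⟨by linarith [hξ.1, hξ.2, hv.1, hv.2], by linarith [hξ.1, hξ.2, hv.1, hv.2]⟩) (abs_nonneg _)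
    · subst hv0; rw [h10]; simp
    · obtain ⟨ξ, hξ, e⟩ := exists_hasDerivAt_eq_slope ψ₁ ψ₂ hv0 (fun t _ => (hd1 t).continuousAt.continuousWithinAt)
        (fun t _ => hd1 t)
      rw [h10] at e
      have e' : ψ₁ v = ψ₂ ξ * v := by
        have : ψ₁ v - 0 = ψ₂ ξ * (v - 0) := by rw [e, div_mul_cancel₀ _ (sub_ne_zero.2 hv0.ne')]
        linarith
      rw [e', abs_mul]
      exact mul_le_mul_of_nonneg_right (hη ξ ⟨by linarith [hξ.1, hξ.2, hv.1, hv.2], by linarith [hξ.1, hξ.2, hv.1, hv.2]⟩) (abs_nonneg _)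
  rcases lt_trichotomy u 0 with hu0 | hu0 | hu0
  · obtain ⟨ξ, hξ, e⟩ := exists_hasDerivAt_eq_slope ψ ψ₁ hu0 (fun t _ => (hd t).continuousAt.continuousWithinAt) (fun t _ => hd t)
    rw [h0] at e
    have e' : ψ u = ψ₁ ξ * u := by
      have : 0 - ψ u = ψ₁ ξ * (0 - u) := by rw [e, div_mul_cancel₀ _ (sub_ne_zero.2 hu0.ne')]
      linarith
    have hξb := step1 ξ ⟨by linarith [hξ.1, hξ.2, hu.1, hu.2], by linarith [hξ.1, hξ.2, hu.1, hu.2]⟩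
    rw [e', abs_mul]
    have : |ξ| ≤ |u| := by rw [abs_of_neg hξ.2, abs_of_neg hu0]; linarith [hξ.1]
    calc |ψ₁ ξ| * |u| ≤ η * |ξ| * |u| := mul_le_mul_of_nonneg_right hξb (abs_nonneg _)
      _ ≤ η * |u| * |u| := by gcongr
      _ = η * u ^ 2 := by rw [mul_assoc, ← sq, sq_abs]
  · subst hu0; rw [h0]; simp
  · obtain ⟨ξ, hξ, e⟩ := exists_hasDerivAt_eq_slope ψ ψ₁ hu0 (fun t _ => (hd t).continuousAt.continuousWithinAt) (fun t _ => hd t)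
    rw [h0] at e
    have e' : ψ u = ψ₁ ξ * u := by
      have : ψ u - 0 = ψ₁ ξ * (u - 0) := by rw [e, div_mul_cancel₀ _ (sub_ne_zero.2 hu0.ne')]
      linarith
    have hξb := step1 ξ ⟨by linarith [hξ.1, hξ.2, hu.1, hu.2], by linarith [hξ.1, hξ.2, hu.1, hu.2]⟩
    rw [e', abs_mul]
    have : |ξ| ≤ |u| := by rw [abs_of_pos hξ.1, abs_of_pos hu0]; linarith [hξ.2]
    calc |ψ₁ ξ| * |u| ≤ η * |ξ| * |u| := mul_le_mul_of_nonneg_right hξb (abs_nonneg _)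
      _ ≤ η * |u| * |u| := by gcongr
      _ = η * u ^ 2 := by rw [mul_assoc, ← sq, sq_abs]

/-! ## §2 ★★★ The log-mgf expansion, uniform in `|s| ≤ δ√N` -/

/-- `N/2 → ∞` along `ℕ`. [cite: DemboZeitouni2010, §2.3 (lane plumbing)] -/
private theorem tendsto_nat_div_two₃ : Tendsto (fun N : ℕ => N / 2) atTop atTop :=
  tendsto_atTop_atTop.2 fun b => ⟨2 * b, fun N h => by omega⟩

/-- ★★★ **THE LOG-MGF EXPANSION, UNIFORM IN THE TILT**: for all `y, z > 0` and every `η > 0` there is `δ > 0` such that, for all large `N` and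
ALL real `s` with `|s| ≤ δ√N`, `|log (C_{1,N}(y e^{s/√N},z)/C_{1,N}(y,z) · e^{−s√N b}) − σ²s²/2| ≤ η·s² + η`, `σ² = d/dA b(e^A,z)|_{A = log y}`.
[cite: DemboZeitouni2010, §2.3 (lane statement: local expansion of the logarithmic mgf); MadrasSlade1993, §1.1 eq. (1.1.4) p. 5; BeatonBousquetMelouDeGierDuminilCopinGuttmann2014, §3.2 Proposition 6 (arXiv v5 p. 10)] -/
theorem abs_log_contactMGF_sub_le (hy : 0 < y) (hz : 0 < z) {η : ℝ} (hη : 0 < η) :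
    ∃ δ : ℝ, 0 < δ ∧ ∀ᶠ N : ℕ in atTop, ∀ s : ℝ, |s| ≤ δ * Real.sqrt N →
      |Real.log (stripZ₂ 1 N (y * Real.exp (s / Real.sqrt N)) z / stripZ₂ 1 N y z
          * Real.exp (-(s * Real.sqrt N * contactB y z)))
        - deriv (fun A => contactB (Real.exp A) z) (Real.log y) * s ^ 2 / 2| ≤ η * s ^ 2 + η := by
  set A₀ := Real.log y with hA₀
  set B := Real.log z with hBdef
  have hyA : Real.exp A₀ = y := Real.exp_log hy
  have hzB : Real.exp B = z := Real.exp_log hz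
  obtain ⟨Λ, hΛdef⟩ : ∃ Λ : ℝ → ℝ, Λ = fun A => Real.log (stripMuY₂ 1 (Real.exp A) (Real.exp B)) := ⟨_, rfl⟩
  have hΛ2 : ContDiff ℝ 2 Λ := by rw [hΛdef]; exact (contDiff_two_log_stripMuY₂_exp B).1
  have hΛd : deriv Λ = fun A => contactB (Real.exp A) (Real.exp B) := by rw [hΛdef]; exact (contDiff_two_log_stripMuY₂_exp B).2
  obtain ⟨hΛ1, hΛ11, hΛ2c, -⟩ := derivData_of_contDiff_two₃ hΛ2 1
  set b := contactB y z with hb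
  set σ2 := deriv (deriv Λ) A₀ with hσ2
  have hσ : deriv (fun A => contactB (Real.exp A) z) A₀ = σ2 := by rw [hσ2, hΛd, hzB]
  have hbΛ : deriv Λ A₀ = b := by rw [hΛd]; simp only [hyA, hzB, hb]
  -- Taylor remainder of `Λ` at `A₀`
  set ψ : ℝ → ℝ := fun v => Λ (A₀ + v) - Λ A₀ - b * v - σ2 * (v * v) / 2 with hψ
  set ψ1 : ℝ → ℝ := fun v => deriv Λ (A₀ + v) - b - σ2 * v with hψ1
  set ψ2 : ℝ → ℝ := fun v => deriv (deriv Λ) (A₀ + v) - σ2 with hψ2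
  have hshift : ∀ t, HasDerivAt (fun t : ℝ => A₀ + t) 1 t := fun t => by simpa using (hasDerivAt_id t).const_add A₀
  have hψd : ∀ v, HasDerivAt ψ (ψ1 v) v := by
    intro v
    have h1 : HasDerivAt (fun v => Λ (A₀ + v)) (deriv Λ (A₀ + v)) v := by
      have h := (hΛ1 (A₀ + v)).comp v (hshift v); rw [mul_one] at h; exact h
    have h2 : HasDerivAt (fun v : ℝ => b * v) b v := by simpa using (hasDerivAt_id v).const_mul b
    have h3 : HasDerivAt (fun v : ℝ => σ2 * (v * v) / 2) (σ2 * v) v := by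
      have h := (((hasDerivAt_id' v).mul (hasDerivAt_id' v)).const_mul σ2).div_const 2
      exact h.congr_deriv (by ring)
    have h4 : HasDerivAt (fun v => Λ (A₀ + v) - Λ A₀ - b * v - σ2 * (v * v) / 2) (deriv Λ (A₀ + v) - b - σ2 * v) v :=
      ((h1.sub_const (Λ A₀)).sub h2).sub h3
    exact h4
  have hψ1d : ∀ v, HasDerivAt ψ1 (ψ2 v) v := by
    intro v
    have h1 : HasDerivAt (fun v => deriv Λ (A₀ + v)) (deriv (deriv Λ) (A₀ + v)) v := by
      have h := (hΛ11 (A₀ + v)).comp v (hshift v); rw [mul_one] at h; exact h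
    have h3 : HasDerivAt (fun v : ℝ => σ2 * v) σ2 v := by simpa using (hasDerivAt_id v).const_mul σ2
    have h4 : HasDerivAt (fun v => deriv Λ (A₀ + v) - b - σ2 * v) (deriv (deriv Λ) (A₀ + v) - σ2) v :=
      (h1.sub_const b).sub h3
    exact h4
  have hψ0 : ψ 0 = 0 := by simp [hψ]
  have hψ10 : ψ1 0 = 0 := by simp [hψ1, hbΛ]
  -- (1) `|ψ v| ≤ (η/2) v²` on `|v| ≤ δ₁`
  have hc : ContinuousAt ψ2 0 := by
    have : Continuous ψ2 := by
      rw [hψ2]; exact (hΛ2c.comp (continuous_const.add continuous_id)).sub continuous_const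
    exact this.continuousAt
  have hψ20 : ψ2 0 = 0 := by simp [hψ2, hσ2]
  obtain ⟨δ₁, hδ₁, hδ₁b⟩ := (Metric.continuousAt_iff.1 hc) (η / 2) (by positivity)
  have hψb : ∀ v ∈ Icc (-(δ₁ / 2)) (δ₁ / 2), |ψ v| ≤ η / 2 * v ^ 2 := by
    intro v hv
    refine abs_le_of_second_deriv_bound₃ hψ0 hψ10 hψd hψ1d (fun w hw => ?_) hv
    have : dist w 0 < δ₁ := by rw [Real.dist_eq, sub_zero]; exact lt_of_le_of_lt (abs_le.2 ⟨hw.1, hw.2⟩) (by linarith)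
    have h := hδ₁b this
    rw [hψ20, Real.dist_eq, sub_zero] at h
    exact h.le
  -- (2) continuity of the amplitude corrections
  set LA : ℕ → ℝ → ℝ := fun c v => Real.log (parityAmplitude c (Real.exp (A₀ + v)) (Real.exp B)) with hLA
  have hLAc : ∀ c, c < 2 → ∃ δ' : ℝ, 0 < δ' ∧ ∀ v : ℝ, |v| ≤ δ' → |LA c v - LA c 0| ≤ η / 4 := by
    intro c hc
    have hG2 := contDiff_two_parityG A₀ B hc
    have hcont : Continuous (LA c) := by
      have h1 : Continuous (fun t => (c : ℝ) * Real.log (stripMuY₂ 1 (Real.exp (A₀ + t)) (Real.exp B))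
          + Real.log (parityAmplitude c (Real.exp (A₀ + t)) (Real.exp B))) := hG2.continuous
      have h2 : Continuous (fun t => (c : ℝ) * Λ (A₀ + t)) :=
        continuous_const.mul (hΛ2.continuous.comp (continuous_const.add continuous_id))
      have e : LA c = fun t => ((c : ℝ) * Real.log (stripMuY₂ 1 (Real.exp (A₀ + t)) (Real.exp B))
          + Real.log (parityAmplitude c (Real.exp (A₀ + t)) (Real.exp B))) - (c : ℝ) * Λ (A₀ + t) := by
        funext t; simp only [hLA, hΛdef]; ring
      rw [e]; exact h1.sub h2
    obtain ⟨δ', hδ', hb'⟩ := (Metric.continuousAt_iff.1 (hcont.continuousAt (x := 0))) (η / 4) (by positivity)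
    refine ⟨δ' / 2, by positivity, fun v hv => ?_⟩
    have : dist v 0 < δ' := by rw [Real.dist_eq, sub_zero]; linarith
    have h := hb' this
    rw [Real.dist_eq] at h
    exact h.le
  obtain ⟨δa, hδa, hδab⟩ := hLAc 0 (by norm_num)
  obtain ⟨δb, hδb, hδbb⟩ := hLAc 1 (by norm_num)
  -- (3) the uniform remainders on `[e^{A₀−1}, e^{A₀+1}]`
  set y₁ := Real.exp (A₀ - 1) with hy₁def
  set y₂ := Real.exp (A₀ + 1) with hy₂def
  have hy₁ : 0 < y₁ := Real.exp_pos _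
  have h12 : y₁ ≤ y₂ := Real.exp_le_exp.2 (by linarith)
  have hrem : ∀ c, c < 2 → ∃ ε : ℕ → ℝ, Tendsto ε atTop (𝓝 0) ∧ ∀ M : ℕ, ∀ y' ∈ Icc y₁ y₂,
      |Real.log (stripZ₂ 1 (2 * M + c) y' z) - (2 * M + c) * Real.log (stripMuY₂ 1 y' z) - Real.log (parityAmplitude c y' z)| ≤ ε M := by
    intro c hc
    obtain ⟨a₁, a₂, ha₁, hA⟩ := parityAmplitude_bounds hz hy₁ h12 hc
    obtain ⟨ε, hεlim, hεb⟩ := exists_uniform_log_two_term hz hy₁ h12 hc ha₁ hA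
      (fun y' hy' => tendsto_parityAmplitude (lt_of_lt_of_le hy₁ hy'.1) hz hc)
    refine ⟨ε, ?_, hεb⟩
    have hε0 : ∀ M, 0 ≤ ε M := fun M => le_trans (abs_nonneg _) (hεb M y₁ ⟨le_rfl, h12⟩)
    refine squeeze_zero' (Filter.Eventually.of_forall hε0) ?_ hεlim
    filter_upwards [eventually_ge_atTop 1] with M hM
    have hM1' : (1 : ℝ) ≤ M := by exact_mod_cast hM
    nlinarith [hε0 M]
  obtain ⟨ε0, hε0lim, hε0b⟩ := hrem 0 (by norm_num)
  obtain ⟨ε1, hε1lim, hε1b⟩ := hrem 1 (by norm_num)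
  have hmemI : ∀ v : ℝ, |v| ≤ 1 → Real.exp (A₀ + v) ∈ Icc y₁ y₂ := fun v hv =>
    ⟨Real.exp_le_exp.2 (by linarith [neg_abs_le v]), Real.exp_le_exp.2 (by linarith [le_abs_self v])⟩
  have hsmall : ∀ᶠ N : ℕ in atTop, |ε0 (N / 2)| + |ε1 (N / 2)| ≤ η / 4 := by
    have c0 := (hε0lim.comp tendsto_nat_div_two₃).abs
    have c1 := (hε1lim.comp tendsto_nat_div_two₃).abs
    simp only [abs_zero] at c0 c1
    have := c0.add c1
    rw [add_zero] at this
    have h4 : (0 : ℝ) < η / 4 := by positivity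
    exact (this.eventually (Iic_mem_nhds h4)).mono fun N hN => hN
  -- the radius
  set δ := min (min (δ₁ / 2) δa) (min δb 1) with hδ
  have hδ0 : 0 < δ := by positivity
  refine ⟨δ, hδ0, ?_⟩
  filter_upwards [eventually_ge_atTop 1, hsmall] with N hN1 hsm
  intro s hs
  have hNr : (0 : ℝ) < N := by exact_mod_cast hN1
  have hsq : 0 < Real.sqrt (N : ℝ) := Real.sqrt_pos.2 hNr
  obtain ⟨v, hv⟩ : ∃ v : ℝ, v = s / Real.sqrt N := ⟨_, rfl⟩
  rw [← hv]
  have hvabs : |v| ≤ δ := by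
    rw [hv, abs_div, abs_of_pos hsq, div_le_iff₀ hsq]; exact hs
  have hv1 : |v| ≤ 1 := le_trans hvabs (le_trans (min_le_right _ _) (min_le_right _ _))
  have hvδ₁ : v ∈ Icc (-(δ₁ / 2)) (δ₁ / 2) := by
    have : |v| ≤ δ₁ / 2 := le_trans hvabs (le_trans (min_le_left _ _) (min_le_left _ _))
    exact ⟨by linarith [neg_abs_le v], by linarith [le_abs_self v]⟩
  have hva : |v| ≤ δa := le_trans hvabs (le_trans (min_le_left _ _) (min_le_right _ _))
  have hvb : |v| ≤ δb := le_trans hvabs (le_trans (min_le_right _ _) (min_le_left _ _))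
  have hNv : (N : ℝ) * v = s * Real.sqrt N ∧ (N : ℝ) * v ^ 2 = s ^ 2 := by
    have hNN : (N : ℝ) = Real.sqrt N * Real.sqrt N := (Real.mul_self_sqrt hNr.le).symm
    rw [hv]
    constructor
    · nth_rewrite 1 [hNN]; field_simp
    · rw [div_pow, Real.sq_sqrt hNr.le]; field_simp
  -- parity split
  obtain ⟨M, c, hc, hNMc⟩ : ∃ M c : ℕ, c < 2 ∧ N = 2 * M + c := ⟨N / 2, N % 2, Nat.mod_lt _ (by norm_num), (Nat.div_add_mod N 2).symm⟩
  have hMdiv : N / 2 = M := by omega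
  have hC1 := stripZ₂_pos 1 N (mul_pos hy (Real.exp_pos v)) hz
  have hC0 := stripZ₂_pos 1 N hy hz
  have hE := Real.exp_pos (-(s * Real.sqrt N * b))
  have ey1 : y * Real.exp v = Real.exp (A₀ + v) := by rw [Real.exp_add, hyA]
  have ey0 : y = Real.exp (A₀ + 0) := by rw [add_zero, hyA]
  have eNr : (N : ℝ) = 2 * (M : ℝ) + c := by rw [hNMc]; push_cast; ring
  have hrem2 : ∀ w : ℝ, |w| ≤ 1 →
      |Real.log (stripZ₂ 1 N (Real.exp (A₀ + w)) z) - N * Λ (A₀ + w) - LA c w| ≤ |ε0 (N / 2)| + |ε1 (N / 2)| := by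
    intro w hw
    have eΛ : Λ (A₀ + w) = Real.log (stripMuY₂ 1 (Real.exp (A₀ + w)) z) := by rw [hΛdef, hzB]
    have eL : LA c w = Real.log (parityAmplitude c (Real.exp (A₀ + w)) z) := by rw [hLA, hzB]
    rw [eΛ, eL, hMdiv, eNr]
    interval_cases c
    · have key := hε0b M _ (hmemI w hw)
      rw [← hNMc] at key
      push_cast at key ⊢
      simp only [add_zero] at key ⊢
      exact le_trans key (by linarith [le_abs_self (ε0 M), abs_nonneg (ε1 M)])
    · have key := hε1b M _ (hmemI w hw)
      rw [← hNMc] at key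
      push_cast at key ⊢
      exact le_trans key (by linarith [le_abs_self (ε1 M), abs_nonneg (ε0 M)])
  have hr1 := hrem2 v hv1
  have hr0 := hrem2 0 (by simp)
  have hLAd : |LA c v - LA c 0| ≤ η / 4 := by
    interval_cases c
    · exact hδab v hva
    · exact hδbb v hvb
  have hψv : |(N : ℝ) * ψ v| ≤ η / 2 * s ^ 2 := by
    rw [abs_mul, abs_of_nonneg (Nat.cast_nonneg N)]
    calc (N : ℝ) * |ψ v| ≤ (N : ℝ) * (η / 2 * v ^ 2) := mul_le_mul_of_nonneg_left (hψb v hvδ₁) (Nat.cast_nonneg N)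
      _ = η / 2 * ((N : ℝ) * v ^ 2) := by ring
      _ = η / 2 * s ^ 2 := by rw [hNv.2]
  -- the algebra
  have hlog : Real.log (stripZ₂ 1 N (y * Real.exp v) z / stripZ₂ 1 N y z * Real.exp (-(s * Real.sqrt N * b)))
      = Real.log (stripZ₂ 1 N (Real.exp (A₀ + v)) z) - Real.log (stripZ₂ 1 N (Real.exp (A₀ + 0)) z) - s * Real.sqrt N * b := by
    rw [Real.log_mul (div_pos hC1 hC0).ne' hE.ne', Real.log_div hC1.ne' hC0.ne', Real.log_exp, ey1, ← ey0]
    ring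
  obtain ⟨e1, e2⟩ := hNv
  have hid : Real.log (stripZ₂ 1 N (Real.exp (A₀ + v)) z) - Real.log (stripZ₂ 1 N (Real.exp (A₀ + 0)) z)
        - s * Real.sqrt N * b - σ2 * s ^ 2 / 2
      = (N : ℝ) * ψ v + (LA c v - LA c 0)
        + ((Real.log (stripZ₂ 1 N (Real.exp (A₀ + v)) z) - N * Λ (A₀ + v) - LA c v)
          - (Real.log (stripZ₂ 1 N (Real.exp (A₀ + 0)) z) - N * Λ (A₀ + 0) - LA c 0)) := by
    simp only [hψ, add_zero]
    have e1' : s * Real.sqrt N * b = (N : ℝ) * v * b := by rw [e1]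
    have e2' : σ2 * s ^ 2 / 2 = (N : ℝ) * v ^ 2 * σ2 / 2 := by rw [e2]; ring
    rw [e1', e2']
    ring
  rw [hσ, hlog]
  have hfin : |Real.log (stripZ₂ 1 N (Real.exp (A₀ + v)) z) - Real.log (stripZ₂ 1 N (Real.exp (A₀ + 0)) z)
        - s * Real.sqrt N * b - σ2 * s ^ 2 / 2| ≤ η / 2 * s ^ 2 + η / 4 + 2 * (|ε0 (N / 2)| + |ε1 (N / 2)|) := by
    rw [hid]
    calc |(N : ℝ) * ψ v + (LA c v - LA c 0)
          + ((Real.log (stripZ₂ 1 N (Real.exp (A₀ + v)) z) - N * Λ (A₀ + v) - LA c v)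
            - (Real.log (stripZ₂ 1 N (Real.exp (A₀ + 0)) z) - N * Λ (A₀ + 0) - LA c 0))|
        ≤ |(N : ℝ) * ψ v| + |LA c v - LA c 0|
          + (|Real.log (stripZ₂ 1 N (Real.exp (A₀ + v)) z) - N * Λ (A₀ + v) - LA c v|
            + |Real.log (stripZ₂ 1 N (Real.exp (A₀ + 0)) z) - N * Λ (A₀ + 0) - LA c 0|) :=
          le_trans (abs_add_le _ _) (add_le_add (abs_add_le _ _) (abs_sub _ _))
      _ ≤ _ := by linarith [hψv, hLAd, hr1, hr0]
  have hη2 : 0 ≤ η / 2 * s ^ 2 := by positivity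
  refine le_trans hfin ?_
  linarith [hsm, hη2]

/-! ## §3 ★★★ Moderate deviations: Gaussian-rate tails at all scales `√N ≪ a_N ≪ N` -/

/-- The variance rate is positive. [cite: DemboZeitouni2010, §2.3 (lane statement)] -/
private theorem deriv_contactB_exp_pos₃ (hy : 0 < y) (hz : 0 < z) : 0 < deriv (fun A => contactB (Real.exp A) z) (Real.log y) := by
  have h := hasDerivAt_contactB_log (Real.log y) (Real.log z)
  simp only [Real.exp_log hy, Real.exp_log hz] at h
  obtain ⟨-, -, dA, -, -, hpos, -⟩ := h
  rw [dA.deriv]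
  exact hpos

open Classical in
/-- ★★★ **MODERATE DEVIATIONS, UPPER TAIL, GAUSSIAN RATE**: for all `y, z > 0`, every sequence `x_N → ∞` with `x_N/√N → 0` and every `η > 0`,
for all large `N`: `P_{N,y,z}(bc ≥ N·b + x_N√N) ≤ exp(−(1−η)·x_N²/(2σ²))`, `σ² = d/dA b(e^A,z)|_{log y}` — exponential Chebyshev at the tilt
`s_N = x_N/σ²` (admissible since `s_N/√N → 0`) and the uniform expansion `abs_log_contactMGF_sub_le`.
[cite: DemboZeitouni2010, §3.7 (moderate deviations) and §2.3 (exponential Chebyshev); lane statement] -/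
theorem eventually_contactUpperTail_le_exp_moderate (hy : 0 < y) (hz : 0 < z) {x : ℕ → ℝ} (hx : Tendsto x atTop atTop)
    (hxN : Tendsto (fun N => x N / Real.sqrt N) atTop (𝓝 0)) {η : ℝ} (hη : 0 < η) :
    ∀ᶠ N : ℕ in atTop,
      (∑ q ∈ (stripPairs 1 N).filter (fun q => (N : ℝ) * contactB y z + x N * Real.sqrt N ≤ (bottomVisits₀ q.1 q.2 N : ℝ)), wgt y z N q)
          / stripZ₂ 1 N y z
        ≤ Real.exp (-((1 - η) * x N ^ 2 / (2 * deriv (fun A => contactB (Real.exp A) z) (Real.log y)))) := by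
  set σ2 := deriv (fun A => contactB (Real.exp A) z) (Real.log y) with hσ2
  set b := contactB y z with hb
  have hσ : 0 < σ2 := deriv_contactB_exp_pos₃ hy hz
  -- the uniform expansion with `η' = η σ²/4`
  obtain ⟨δ, hδ, hunif⟩ := abs_log_contactMGF_sub_le hy hz (show 0 < η * σ2 / 4 by positivity)
  -- eventually: `x_N ≥ σ²` (so that `η' ≤ η' x²/σ⁴`-type absorption works), `x_N > 0`, `s_N ≤ δ√N`
  have hx1 : ∀ᶠ N : ℕ in atTop, σ2 ≤ x N := hx.eventually (eventually_ge_atTop σ2)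
  have hx2 : ∀ᶠ N : ℕ in atTop, x N / Real.sqrt N ≤ δ * σ2 := by
    have : (0 : ℝ) < δ * σ2 := by positivity
    exact (hxN.eventually (Iic_mem_nhds this)).mono fun N hN => hN
  filter_upwards [hunif, hx1, hx2, eventually_ge_atTop 1] with N hU hxσ hxs hN1
  have hNr : (0 : ℝ) < N := by exact_mod_cast hN1
  have hsq : 0 < Real.sqrt (N : ℝ) := Real.sqrt_pos.2 hNr
  have hxpos : 0 < x N := lt_of_lt_of_le hσ hxσ
  set s := x N / σ2 with hs
  have hs0 : 0 < s := div_pos hxpos hσ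
  have hsδ : |s| ≤ δ * Real.sqrt N := by
    rw [abs_of_pos hs0, hs, div_le_iff₀ hσ]
    have := (div_le_iff₀ hsq).1 hxs
    nlinarith
  have hlogM := hU s hsδ
  rw [← hσ2] at hlogM
  -- Chernoff
  set u := Real.exp (s / Real.sqrt N) with hu
  have hu1 : 1 ≤ u := Real.one_le_exp (div_pos hs0 hsq).le
  have hupos : 0 < u := Real.exp_pos _
  set κ := ((N : ℝ) * b + x N * Real.sqrt N) / N with hκ
  have hκN : κ * N = (N : ℝ) * b + x N * Real.sqrt N := by rw [hκ]; field_simp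
  have hcher := sum_contacts_ge_mul_rpow_le hy.le hz.le hu1 N κ
  rw [hκN] at hcher
  have hZ := stripZ₂_pos 1 N hy hz
  have hupow : 0 < u ^ ((N : ℝ) * b + x N * Real.sqrt N) := Real.rpow_pos_of_pos hupos _
  set MN := stripZ₂ 1 N (y * Real.exp (s / Real.sqrt N)) z / stripZ₂ 1 N y z * Real.exp (-(s * Real.sqrt N * b)) with hMN
  have hMpos : 0 < MN := mul_pos (div_pos (stripZ₂_pos 1 N (mul_pos hy (Real.exp_pos _)) hz) hZ) (Real.exp_pos _)
  have hkey : (∑ q ∈ (stripPairs 1 N).filter (fun q => (N : ℝ) * b + x N * Real.sqrt N ≤ (bottomVisits₀ q.1 q.2 N : ℝ)), wgt y z N q)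
        / stripZ₂ 1 N y z ≤ MN * Real.exp (-(s * x N)) := by
    have e1 : u ^ ((N : ℝ) * b + x N * Real.sqrt N) = Real.exp (s * Real.sqrt N * b) * Real.exp (s * x N) := by
      rw [hu, ← Real.exp_mul, ← Real.exp_add]
      congr 1
      rw [div_mul_eq_mul_div, div_eq_iff hsq.ne']
      linear_combination (-(s * b)) * Real.mul_self_sqrt hNr.le
    have h1 : (∑ q ∈ (stripPairs 1 N).filter (fun q => (N : ℝ) * b + x N * Real.sqrt N ≤ (bottomVisits₀ q.1 q.2 N : ℝ)), wgt y z N q)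
        ≤ stripZ₂ 1 N (y * u) z / u ^ ((N : ℝ) * b + x N * Real.sqrt N) := by
      rw [le_div_iff₀ hupow]; exact hcher
    calc _ ≤ stripZ₂ 1 N (y * u) z / u ^ ((N : ℝ) * b + x N * Real.sqrt N) / stripZ₂ 1 N y z :=
          div_le_div_of_nonneg_right h1 hZ.le
      _ = _ := by
          rw [e1, hu, hMN, Real.exp_neg, Real.exp_neg]
          field_simp
  refine le_trans hkey ?_
  -- `MN e^{−s x} = exp(log MN − s x) ≤ exp(σ²s²/2 + η's² + η' − s x) ≤ exp(−(1−η)x²/(2σ²))`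
  rw [← Real.exp_log hMpos, ← Real.exp_add]
  apply Real.exp_le_exp.2
  have hab := (abs_le.1 hlogM).2
  -- `log MN ≤ σ² s²/2 + η' s² + η'` with `η' = ησ²/4`, `s = x/σ²`
  have hsx : s * x N = x N ^ 2 / σ2 := by rw [hs]; field_simp
  have hs2 : s ^ 2 = x N ^ 2 / σ2 ^ 2 := by rw [hs, div_pow]
  rw [hsx]
  rw [hs2] at hab
  have hx2 : σ2 ^ 2 ≤ x N ^ 2 := by nlinarith [hxσ, hσ]
  -- target after clearing denominators
  have hσ2pos : 0 < σ2 ^ 2 := by positivity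
  have key : σ2 * (x N ^ 2 / σ2 ^ 2) / 2 + (η * σ2 / 4 * (x N ^ 2 / σ2 ^ 2) + η * σ2 / 4) - x N ^ 2 / σ2
      ≤ -((1 - η) * x N ^ 2 / (2 * σ2)) := by
    have t1 : σ2 * (x N ^ 2 / σ2 ^ 2) / 2 = x N ^ 2 / (2 * σ2) := by field_simp
    have e3 : η * σ2 / 4 * (x N ^ 2 / σ2 ^ 2) = η * x N ^ 2 / (4 * σ2) := by field_simp
    have e4 : η * σ2 / 4 ≤ η * x N ^ 2 / (4 * σ2) := by
      have h4 : (0 : ℝ) < 4 * σ2 := by positivity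
      rw [le_div_iff₀ h4]
      have := mul_le_mul_of_nonneg_left hx2 hη.le
      linarith only [this]
    have e5 : x N ^ 2 / (2 * σ2) + (η * x N ^ 2 / (4 * σ2) + η * x N ^ 2 / (4 * σ2)) - x N ^ 2 / σ2
        = -((1 - η) * x N ^ 2 / (2 * σ2)) := by field_simp; ring
    rw [t1, e3]; linarith only [e4, e5]
  linarith only [hab, key]

open Classical in
/-- ★★★ **MODERATE DEVIATIONS, LOWER TAIL, GAUSSIAN RATE**: for all `y, z > 0`, every sequence `x_N → ∞` with `x_N/√N → 0` and every `η > 0`,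
for all large `N`: `P_{N,y,z}(bc ≤ N·b − x_N√N) ≤ exp(−(1−η)·x_N²/(2σ²))` (tilt `s_N = −x_N/σ²`).
[cite: DemboZeitouni2010, §3.7 (moderate deviations) and §2.3 (exponential Chebyshev); lane statement] -/
theorem eventually_contactLowerTail_le_exp_moderate (hy : 0 < y) (hz : 0 < z) {x : ℕ → ℝ} (hx : Tendsto x atTop atTop)
    (hxN : Tendsto (fun N => x N / Real.sqrt N) atTop (𝓝 0)) {η : ℝ} (hη : 0 < η) :
    ∀ᶠ N : ℕ in atTop,
      (∑ q ∈ (stripPairs 1 N).filter (fun q => (bottomVisits₀ q.1 q.2 N : ℝ) ≤ (N : ℝ) * contactB y z - x N * Real.sqrt N), wgt y z N q)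
          / stripZ₂ 1 N y z
        ≤ Real.exp (-((1 - η) * x N ^ 2 / (2 * deriv (fun A => contactB (Real.exp A) z) (Real.log y)))) := by
  set σ2 := deriv (fun A => contactB (Real.exp A) z) (Real.log y) with hσ2
  set b := contactB y z with hb
  have hσ : 0 < σ2 := deriv_contactB_exp_pos₃ hy hz
  obtain ⟨δ, hδ, hunif⟩ := abs_log_contactMGF_sub_le hy hz (show 0 < η * σ2 / 4 by positivity)
  have hx1 : ∀ᶠ N : ℕ in atTop, σ2 ≤ x N := hx.eventually (eventually_ge_atTop σ2)
  have hx2 : ∀ᶠ N : ℕ in atTop, x N / Real.sqrt N ≤ δ * σ2 := by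
    have : (0 : ℝ) < δ * σ2 := by positivity
    exact (hxN.eventually (Iic_mem_nhds this)).mono fun N hN => hN
  filter_upwards [hunif, hx1, hx2, eventually_ge_atTop 1] with N hU hxσ hxs hN1
  have hNr : (0 : ℝ) < N := by exact_mod_cast hN1
  have hsq : 0 < Real.sqrt (N : ℝ) := Real.sqrt_pos.2 hNr
  have hxpos : 0 < x N := lt_of_lt_of_le hσ hxσ
  set s := x N / σ2 with hs
  have hs0 : 0 < s := div_pos hxpos hσ
  have hsδ : |(-s)| ≤ δ * Real.sqrt N := by
    rw [abs_neg, abs_of_pos hs0, hs, div_le_iff₀ hσ]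
    have := (div_le_iff₀ hsq).1 hxs
    nlinarith
  have hlogM := hU (-s) hsδ
  rw [← hσ2] at hlogM
  set u := Real.exp (-s / Real.sqrt N) with hu
  have hupos : 0 < u := Real.exp_pos _
  have hu1 : u ≤ 1 := by
    rw [hu]; apply Real.exp_le_one_iff.2
    exact div_nonpos_of_nonpos_of_nonneg (by linarith) hsq.le
  set κ := ((N : ℝ) * b - x N * Real.sqrt N) / N with hκ
  have hκN : κ * N = (N : ℝ) * b - x N * Real.sqrt N := by rw [hκ]; field_simp
  have hcher := sum_contacts_le_mul_rpow_le hy.le hz.le hupos hu1 N κ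
  rw [hκN] at hcher
  have hZ := stripZ₂_pos 1 N hy hz
  have hupow : 0 < u ^ ((N : ℝ) * b - x N * Real.sqrt N) := Real.rpow_pos_of_pos hupos _
  set MN := stripZ₂ 1 N (y * Real.exp (-s / Real.sqrt N)) z / stripZ₂ 1 N y z * Real.exp (-(-s * Real.sqrt N * b)) with hMN
  have hMpos : 0 < MN := mul_pos (div_pos (stripZ₂_pos 1 N (mul_pos hy (Real.exp_pos _)) hz) hZ) (Real.exp_pos _)
  have hkey : (∑ q ∈ (stripPairs 1 N).filter (fun q => (bottomVisits₀ q.1 q.2 N : ℝ) ≤ (N : ℝ) * b - x N * Real.sqrt N), wgt y z N q)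
        / stripZ₂ 1 N y z ≤ MN * Real.exp (-(s * x N)) := by
    have e1 : u ^ ((N : ℝ) * b - x N * Real.sqrt N) = Real.exp (-(s * Real.sqrt N * b)) * Real.exp (s * x N) := by
      rw [hu, ← Real.exp_mul, ← Real.exp_add]
      congr 1
      rw [div_mul_eq_mul_div, div_eq_iff hsq.ne']
      linear_combination (s * b) * Real.mul_self_sqrt hNr.le
    have h1 : (∑ q ∈ (stripPairs 1 N).filter (fun q => (bottomVisits₀ q.1 q.2 N : ℝ) ≤ (N : ℝ) * b - x N * Real.sqrt N), wgt y z N q)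
        ≤ stripZ₂ 1 N (y * u) z / u ^ ((N : ℝ) * b - x N * Real.sqrt N) := by
      rw [le_div_iff₀ hupow]; exact hcher
    calc _ ≤ stripZ₂ 1 N (y * u) z / u ^ ((N : ℝ) * b - x N * Real.sqrt N) / stripZ₂ 1 N y z :=
          div_le_div_of_nonneg_right h1 hZ.le
      _ = _ := by
          have x1 : Real.exp (-(-s * Real.sqrt N * b)) = Real.exp (s * Real.sqrt N * b) := by congr 1; ring
          have x2 : Real.exp (-(s * Real.sqrt N * b)) = (Real.exp (s * Real.sqrt N * b))⁻¹ := Real.exp_neg _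
          have x3 : Real.exp (-(s * x N)) = (Real.exp (s * x N))⁻¹ := Real.exp_neg _
          rw [e1, hMN, x1, x2, x3, hu]
          field_simp
  refine le_trans hkey ?_
  rw [← Real.exp_log hMpos, ← Real.exp_add]
  apply Real.exp_le_exp.2
  have hab := (abs_le.1 hlogM).2
  have hsx : s * x N = x N ^ 2 / σ2 := by rw [hs]; field_simp
  have hs2 : (-s) ^ 2 = x N ^ 2 / σ2 ^ 2 := by rw [neg_sq, hs, div_pow]
  rw [hsx]
  rw [hs2] at hab
  have hx2 : σ2 ^ 2 ≤ x N ^ 2 := by nlinarith [hxσ, hσ]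
  have hσ2pos : 0 < σ2 ^ 2 := by positivity
  have key : σ2 * (x N ^ 2 / σ2 ^ 2) / 2 + (η * σ2 / 4 * (x N ^ 2 / σ2 ^ 2) + η * σ2 / 4) - x N ^ 2 / σ2
      ≤ -((1 - η) * x N ^ 2 / (2 * σ2)) := by
    have t1 : σ2 * (x N ^ 2 / σ2 ^ 2) / 2 = x N ^ 2 / (2 * σ2) := by field_simp
    have e3 : η * σ2 / 4 * (x N ^ 2 / σ2 ^ 2) = η * x N ^ 2 / (4 * σ2) := by field_simp
    have e4 : η * σ2 / 4 ≤ η * x N ^ 2 / (4 * σ2) := by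
      have h4 : (0 : ℝ) < 4 * σ2 := by positivity
      rw [le_div_iff₀ h4]
      have := mul_le_mul_of_nonneg_left hx2 hη.le
      linarith only [this]
    have e5 : x N ^ 2 / (2 * σ2) + (η * x N ^ 2 / (4 * σ2) + η * x N ^ 2 / (4 * σ2)) - x N ^ 2 / σ2
        = -((1 - η) * x N ^ 2 / (2 * σ2)) := by field_simp; ring
    rw [t1, e3]; linarith only [e4, e5]
  linarith only [hab, key]

end WidthOneYZ

end Literature.Probability.RandomPlanarGeometry.SAW.HexBW
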